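import Literature.MathematicalPhysics.QuantumManyBody.PeriodicBoseGasScatteringWeak
import Literature.MathematicalPhysics.QuantumManyBody.PeriodicBoseGasReduction
import Literature.MathematicalPhysics.QuantumManyBody.PeriodicBoseGasEq225
import HarnessLib

/-!
# Existence of the scattering solution (proof of `LSSY2005_scatteringSolution`)

Topic `Literature/MathematicalPhysics/QuantumManyBody`, sibling of `PeriodicBoseGasScatteringWeak.lean`
(provefact `Literature.MathematicalPhysics.QuantumManyBody.BoseGas.Fournais2020_condensation`). This file
discharges the named fact `LSSY2005_scatteringSolution` (`PeriodicBoseGasLocalization.lean`,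
[LSSY2005, App. C, Thm. C.1] / [Fournais2020, App. A (A.1)–(A.5)]): every non-negative radial
potential of finite range with `∫_{ℝ³} v < ∞` (Assumption 1.1 of [Fournais2020]; hard cores excluded,
`v` may be unbounded and even `= ∞` on a null set) has a scattering solution `ω`.

**Proof (truncation).** For the bounded truncations `v_N = min(v, N)` the solution
`ω_N = 1 - f_N(|x|)` exists by `isScatteringSolution_scatteringOmega` (sibling file), with
`f_N = u_N/(u_N'(R) r)` normalised at a radius `R` beyond the range and scattering lengths
`a_N = a(v_N) ↑`. By the Wronskian comparison (`scatteringProfile_antitone_pot`) the profiles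
decrease, `f_N ↓ f_∞ =: 1 - ω` (`scatteringProfileLim`), and `a_N ↑ a_∞ ≤ R`. Then:
`a_∞ = a(v)` — `≤` by monotonicity of the variational scattering length, `≥` by the radial trial
functions of `v_N` inserted into the functional of `v`, the excess being `½∫(v - v_N) → 0`
(`scatteringLength_eq_iSup`); `ω = a/|x|` beyond the range (pointwise limit); the weak equation
and `∫ v(1-ω) = 8πa` pass to the limit by dominated convergence (`|f_N Δψ| ≤ |Δψ|`,
`v_N f_N |ψ| ≤ v|ψ| ∈ L¹`, `v_N f_N ≤ v`). With `Fournais2020_eq225_holds` this leaves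
`Fournais2020_lemma24` (second quantisation) as the only undischarged input of
`Fournais2020_condensation` (`Fournais2020_condensation_of_lemma24`).

## References

* [LSSY2005] E. H. Lieb, R. Seiringer, J. P. Solovej, J. Yngvason, *The Mathematics of the Bose
  Gas and its Condensation*, Birkhäuser 2005, arXiv:cond-mat/0610117: App. C, Thm. C.1, Lemma C.2.
* [Fournais2020] S. Fournais, *Length scales for BEC in the dilute Bose gas*, arXiv:2011.00309:
  Assumption 1.1, App. A (A.1)–(A.5), Thm. 1.2.
-/

noncomputable section

open MeasureTheory Set Filter Topology Metric
open scoped ENNReal NNReal Laplacian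

namespace Literature.MathematicalPhysics.QuantumManyBody.BoseGas

section Truncation

variable {v : ℝ → ℝ≥0∞} {R : ℝ}

/-- The truncations are bounded: `v_N ≤ N`. [folklore] -/
theorem truncPotential_le_ofReal (v : ℝ → ℝ≥0∞) (N : ℕ) (r : ℝ) :
    truncPotential v N r ≤ ENNReal.ofReal N := by
  rw [ENNReal.ofReal_natCast]; exact truncPotential_le_nat v N r

/-- The truncations have the range of `v`. [folklore] -/
theorem truncPotential_eq_zero_of_range {R : ℝ} (hvR : ∀ s, R < s → v s = 0) (N : ℕ) :
    ∀ s, R < s → truncPotential v N s = 0 := fun s hs => truncPotential_eq_zero (hvR s hs) N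

variable (hv : Measurable v) (hR : 0 < R) (hvR : ∀ s, R < s → v s = 0)
include hv hR hvR

/-- The truncated profiles decrease in `N`. [cite: LSSY2005, App. C, Lemma C.2] -/
theorem scatteringProfile_trunc_antitone (x : Space) :
    Antitone fun N : ℕ => scatteringProfile (truncPotential v N) R x := by
  refine antitone_nat_of_succ_le fun N => ?_
  exact scatteringProfile_antitone_pot (M := (N + 1 : ℕ)) (measurable_truncPotential hv N)
    (measurable_truncPotential hv (N + 1))
    (fun r => (monotone_truncPotential v r (Nat.le_succ N)).trans (truncPotential_le_ofReal v _ r))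
    (truncPotential_le_ofReal v _) (Nat.cast_nonneg _)
    (fun r => monotone_truncPotential v r (Nat.le_succ N)) hR (truncPotential_eq_zero_of_range hvR _) x

/-- `0 < f_N ≤ 1`. [cite: LSSY2005, App. C, Thm. C.1] -/
theorem scatteringProfile_trunc_mem (N : ℕ) (x : Space) :
    0 < scatteringProfile (truncPotential v N) R x ∧ scatteringProfile (truncPotential v N) R x ≤ 1 :=
  scatteringProfile_mem (measurable_truncPotential hv N) (truncPotential_le_ofReal v N) (Nat.cast_nonneg _) hR
    (truncPotential_eq_zero_of_range hvR N) x

/-- **The truncated profiles converge** (monotonically) to the limiting profile. [cite: LSSY2005, App. C, Thm. C.1] -/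
theorem tendsto_scatteringProfile_trunc (x : Space) :
    Tendsto (fun N : ℕ => scatteringProfile (truncPotential v N) R x) atTop (𝓝 (scatteringProfileLim v R x)) :=
  tendsto_atTop_ciInf (scatteringProfile_trunc_antitone hv hR hvR x)
    ⟨0, fun _ ⟨N, hN⟩ => hN ▸ (scatteringProfile_trunc_mem hv hR hvR N x).1.le⟩

/-- `0 ≤ f_∞ ≤ 1`. [cite: LSSY2005, App. C, Thm. C.1] -/
theorem scatteringProfileLim_mem (x : Space) :
    0 ≤ scatteringProfileLim v R x ∧ scatteringProfileLim v R x ≤ 1 := by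
  constructor
  · exact le_ciInf fun N => (scatteringProfile_trunc_mem hv hR hvR N x).1.le
  · exact (ciInf_le ⟨0, fun _ ⟨N, hN⟩ => hN ▸ (scatteringProfile_trunc_mem hv hR hvR N x).1.le⟩ 0).trans
      (scatteringProfile_trunc_mem hv hR hvR 0 x).2

/-- The limiting profile is measurable. [folklore] -/
theorem measurable_scatteringProfileLim : Measurable (scatteringProfileLim v R) :=
  Measurable.iInf fun N => (continuous_scatteringProfile (measurable_truncPotential hv N)
    (truncPotential_le_ofReal v N) (Nat.cast_nonneg _) hR (truncPotential_eq_zero_of_range hvR N)).measurable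

/-- The truncated ODE scattering lengths `a_N` increase in `N`. [cite: LSSY2005, App. C, Lemma C.2] -/
theorem odeScatteringLength_trunc_monotone :
    Monotone fun N : ℕ => odeScatteringLength (truncPotential v N) R := by
  refine monotone_nat_of_le_succ fun N => ?_
  exact odeScatteringLength_mono_pot (M := (N + 1 : ℕ)) (measurable_truncPotential hv N)
    (measurable_truncPotential hv (N + 1))
    (fun r => (monotone_truncPotential v r (Nat.le_succ N)).trans (truncPotential_le_ofReal v _ r))
    (truncPotential_le_ofReal v _) (Nat.cast_nonneg _)
    (fun r => monotone_truncPotential v r (Nat.le_succ N)) hR (truncPotential_eq_zero_of_range hvR _)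

omit hvR in
/-- `0 ≤ a_N < R`. [cite: LSSY2005, App. C, Thm. C.1] -/
theorem odeScatteringLength_trunc_mem (N : ℕ) :
    0 ≤ odeScatteringLength (truncPotential v N) R ∧ odeScatteringLength (truncPotential v N) R < R :=
  ⟨odeScatteringLength_nonneg (measurable_truncPotential hv N) (truncPotential_le_ofReal v N) (Nat.cast_nonneg _) hR.le,
    odeScatteringLength_lt (measurable_truncPotential hv N) (truncPotential_le_ofReal v N) (Nat.cast_nonneg _) hR⟩

/-- The truncated scattering lengths converge to their supremum `a_∞`. [cite: LSSY2005, App. C, Thm. C.1] -/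
theorem tendsto_odeScatteringLength_trunc :
    Tendsto (fun N : ℕ => odeScatteringLength (truncPotential v N) R) atTop
      (𝓝 (⨆ N : ℕ, odeScatteringLength (truncPotential v N) R)) :=
  tendsto_atTop_ciSup (odeScatteringLength_trunc_monotone hv hR hvR)
    ⟨R, fun _ ⟨N, hN⟩ => hN ▸ (odeScatteringLength_trunc_mem hv hR N).2.le⟩

/-- The variational scattering length of a truncation: `a(v_N) = a_N`. [cite: LSSY2005, App. C, Thm. C.1] -/
theorem scatteringLength_trunc (N : ℕ) :
    scatteringLength (truncPotential v N) = ENNReal.ofReal (odeScatteringLength (truncPotential v N) R) :=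
  scatteringLength_eq_ofReal_odeScatteringLength (measurable_truncPotential hv N) (truncPotential_le_ofReal v N)
    (Nat.cast_nonneg _) hR (truncPotential_eq_zero_of_range hvR N)

end Truncation

/-! ### The scattering length of `v` is the limit of the truncated ones -/

section Limit

variable {v : ℝ → ℝ≥0∞} {R : ℝ}
variable (hv : Measurable v) (hR : 0 < R) (hvR : ∀ s, R < s → v s = 0) (hint : (∫⁻ x : Space, v ‖x‖) ≠ ⊤)
include hv hR hvR

/-- `a_∞ ≤ a(v)` (monotonicity of the variational scattering length). [cite: LSSY2005, App. C, Lemma C.2] -/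
theorem ofReal_iSup_odeScatteringLength_le :
    ENNReal.ofReal (⨆ N : ℕ, odeScatteringLength (truncPotential v N) R) ≤ scatteringLength v := by
  have hbdd : BddAbove (range fun N : ℕ => odeScatteringLength (truncPotential v N) R) :=
    ⟨R, fun _ ⟨N, hN⟩ => hN ▸ (odeScatteringLength_trunc_mem hv hR N).2.le⟩
  rcases eq_or_ne (scatteringLength v) ⊤ with htop | htop
  · rw [htop]; exact le_top
  rw [← ENNReal.ofReal_toReal htop]
  refine ENNReal.ofReal_le_ofReal (ciSup_le fun N => ?_)
  have h := scatteringLength_mono (v := truncPotential v N) (w := v) (truncPotential_le v N)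
  rw [scatteringLength_trunc hv hR hvR N] at h
  exact (ENNReal.ofReal_le_iff_le_toReal htop).mp h

include hint

omit hR hvR in
/-- `∫ v_N ↑ ∫ v`, hence `∫ (v - v_N) → 0`. [folklore] -/
theorem tendsto_lintegral_sub_trunc :
    Tendsto (fun N : ℕ => ∫⁻ x : Space, (v ‖x‖ - truncPotential v N ‖x‖)) atTop (𝓝 0) := by
  have hm : ∀ N, Measurable fun x : Space => truncPotential v N ‖x‖ := fun N =>
    (measurable_truncPotential hv N).comp measurable_norm
  have hmono : Monotone fun N => fun x : Space => truncPotential v N ‖x‖ := fun N N' h x =>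
    monotone_truncPotential v ‖x‖ h
  have hsup : ∫⁻ x : Space, v ‖x‖ = ⨆ N : ℕ, ∫⁻ x : Space, truncPotential v N ‖x‖ := by
    rw [← lintegral_iSup hm hmono]
    refine lintegral_congr fun x => ?_
    exact (iSup_truncPotential v ‖x‖).symm
  have hconv : Tendsto (fun N : ℕ => ∫⁻ x : Space, truncPotential v N ‖x‖) atTop (𝓝 (∫⁻ x : Space, v ‖x‖)) := by
    rw [hsup]
    exact tendsto_atTop_iSup fun N N' h => lintegral_mono fun x => monotone_truncPotential v ‖x‖ h
  have hsub : ∀ N, ∫⁻ x : Space, (v ‖x‖ - truncPotential v N ‖x‖) =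
      (∫⁻ x : Space, v ‖x‖) - ∫⁻ x : Space, truncPotential v N ‖x‖ := by
    intro N
    refine lintegral_sub (hm N) (ne_top_of_le_ne_top hint (lintegral_mono fun x => truncPotential_le v N _)) ?_
    exact Eventually.of_forall fun x => truncPotential_le v N _
  simp_rw [hsub]
  have h := ENNReal.Tendsto.sub (tendsto_const_nhds (x := ∫⁻ x : Space, v ‖x‖)) hconv (Or.inl hint)
  rwa [tsub_self] at h

omit hint in
/-- **`a(v) ≤ a_N + (8π)⁻¹∫(v - v_N)`**: the radial trial functions of the truncation in the
functional of `v`. [cite: LSSY2005, App. C, Thm. C.1 (C.8)] -/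
theorem scatteringLength_le_trunc (N : ℕ) :
    scatteringLength v ≤ ENNReal.ofReal (odeScatteringLength (truncPotential v N) R) +
      (ENNReal.ofReal (4 * Real.pi))⁻¹ * (2⁻¹ * ∫⁻ x : Space, (v ‖x‖ - truncPotential v N ‖x‖)) := by
  set w := truncPotential v N with hw_def
  have hw : Measurable w := measurable_truncPotential hv N
  have hM : ∀ r, w r ≤ ENNReal.ofReal N := truncPotential_le_ofReal v N
  have hM0 : (0 : ℝ) ≤ N := Nat.cast_nonneg _
  have hwR : ∀ s, R < s → w s = 0 := truncPotential_eq_zero_of_range hvR N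
  obtain ⟨Mχ, hMχ0, hMχ⟩ := exists_bound_deriv_smoothTransition
  have ha := odeScatteringLength_nonneg hw hM hM0 hR.le
  set a := odeScatteringLength w R with ha_def
  set K : ℝ := 4 * (1 + Mχ) ^ 2 * a ^ 2 with hK
  have hK0 : 0 ≤ K := by positivity
  have h4 : ENNReal.ofReal (4 * Real.pi) ≠ 0 := by rw [ENNReal.ofReal_ne_zero_iff]; positivity
  set D : ℝ≥0∞ := 2⁻¹ * ∫⁻ x : Space, (v ‖x‖ - w ‖x‖) with hD
  -- the excess of the functional of `v` over that of `w` on functions with values in `[0,1]`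
  have hexcess : ∀ g : ℝ → ℝ, ContDiff ℝ 1 g → (∀ r, 0 ≤ g r ∧ g r ≤ 1) →
      ∫⁻ r in Ioi 0, rayDensity v g r ≤ (∫⁻ r in Ioi 0, rayDensity w g r) + (ENNReal.ofReal (4 * Real.pi))⁻¹ * D := by
    intro g hg hg01
    have key : ∀ A B V d G : ℝ≥0∞, G ≤ 1 →
        A * (B + 2⁻¹ * (V + d) * G) ≤ A * (B + 2⁻¹ * V * G) + A * (2⁻¹ * d) := by
      intro A B V d G hG
      calc A * (B + 2⁻¹ * (V + d) * G) = A * (B + 2⁻¹ * V * G) + A * (2⁻¹ * d * G) := by ring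
        _ ≤ A * (B + 2⁻¹ * V * G) + A * (2⁻¹ * d * 1) := by gcongr
        _ = A * (B + 2⁻¹ * V * G) + A * (2⁻¹ * d) := by rw [mul_one]
    have hpt : ∀ r, rayDensity v g r ≤ rayDensity w g r + ENNReal.ofReal (r ^ 2) * (2⁻¹ * (v r - w r)) := by
      intro r
      have hsplit : v r = w r + (v r - w r) := (add_tsub_cancel_of_le (truncPotential_le v N r)).symm
      have hg1 : ENNReal.ofReal (g r ^ 2) ≤ 1 := by
        rw [← ENNReal.ofReal_one]
        refine ENNReal.ofReal_le_ofReal ?_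
        have := hg01 r; nlinarith
      rw [rayDensity, rayDensity]
      conv_lhs => rw [hsplit]
      exact key _ _ _ _ _ hg1
    have hmeas : Measurable fun r => ENNReal.ofReal (r ^ 2) * (2⁻¹ * (v r - w r)) :=
      (measurable_id.pow_const 2).ennreal_ofReal.mul ((hv.sub hw).const_mul _)
    calc ∫⁻ r in Ioi 0, rayDensity v g r
        ≤ ∫⁻ r in Ioi 0, (rayDensity w g r + ENNReal.ofReal (r ^ 2) * (2⁻¹ * (v r - w r))) :=
          lintegral_mono fun r => hpt r
      _ = (∫⁻ r in Ioi 0, rayDensity w g r) + ∫⁻ r in Ioi 0, ENNReal.ofReal (r ^ 2) * (2⁻¹ * (v r - w r)) :=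
          lintegral_add_right _ hmeas
      _ = (∫⁻ r in Ioi 0, rayDensity w g r) + (ENNReal.ofReal (4 * Real.pi))⁻¹ * D := by
          congr 1
          have hpol := lintegral_comp_norm_eq_sphere (F := fun r => 2⁻¹ * (v r - w r)) ((hv.sub hw).const_mul _)
          rw [hD, ← lintegral_const_mul' _ _ (by norm_num), hpol, ← mul_assoc,
            ENNReal.inv_mul_cancel h4 ENNReal.ofReal_ne_top, one_mul]
  -- for every `T ≥ R`
  have hT : ∀ T : ℝ, R ≤ T → scatteringLength v ≤ ENNReal.ofReal a + ENNReal.ofReal (K / T) +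
      (ENNReal.ofReal (4 * Real.pi))⁻¹ * D := by
    intro T hRT
    have hT0 : 0 < T := hR.trans_le hRT
    have htrial := isScatteringTrial_trialProfile (R := R) hw hM hM0 hT0
    have hgc := trialProfile_contDiff hw hM hM0 R T
    calc scatteringLength v
        ≤ (ENNReal.ofReal (4 * Real.pi))⁻¹ * scatteringFunctional v
            (radialFun fun r => radialProfile w R r + smoothStep T T r * (1 - radialProfile w R r)) :=
          scatteringLength_le htrial
      _ = ∫⁻ r in Ioi 0, rayDensity v (fun r => radialProfile w R r + smoothStep T T r * (1 - radialProfile w R r)) r := by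
          rw [scatteringFunctional_radialFun hgc hv, ← mul_assoc, ENNReal.inv_mul_cancel h4 ENNReal.ofReal_ne_top, one_mul]
      _ ≤ (∫⁻ r in Ioi 0, rayDensity w (fun r => radialProfile w R r + smoothStep T T r * (1 - radialProfile w R r)) r) +
            (ENNReal.ofReal (4 * Real.pi))⁻¹ * D :=
          hexcess _ hgc fun r => trialProfile_mem hw hM hM0 hR hwR T r
      _ ≤ ENNReal.ofReal a + ENNReal.ofReal (K / T) + (ENNReal.ofReal (4 * Real.pi))⁻¹ * D := by
          gcongr
          exact lintegral_rayDensity_trialProfile_le hw hM hM0 hR hwR hMχ0 hMχ hRT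
  -- `T → ∞`
  have hlim : Tendsto (fun T : ℝ => ENNReal.ofReal a + ENNReal.ofReal (K / T) + (ENNReal.ofReal (4 * Real.pi))⁻¹ * D)
      atTop (𝓝 (ENNReal.ofReal a + 0 + (ENNReal.ofReal (4 * Real.pi))⁻¹ * D)) := by
    refine (tendsto_const_nhds.add ?_).add tendsto_const_nhds
    rw [← ENNReal.ofReal_zero]
    exact ENNReal.tendsto_ofReal (tendsto_const_nhds.div_atTop tendsto_id)
  rw [add_zero] at hlim
  exact ge_of_tendsto hlim (eventually_atTop.mpr ⟨R, hT⟩)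

/-- **The scattering length of `v` is the limit of the truncated ones**: `a(v) = a_∞ = sup_N a_N`.
[cite: LSSY2005, App. C, Thm. C.1] -/
theorem scatteringLength_eq_iSup :
    scatteringLength v = ENNReal.ofReal (⨆ N : ℕ, odeScatteringLength (truncPotential v N) R) := by
  refine le_antisymm ?_ (ofReal_iSup_odeScatteringLength_le hv hR hvR)
  have hbdd : BddAbove (range fun N : ℕ => odeScatteringLength (truncPotential v N) R) :=
    ⟨R, fun _ ⟨N, hN⟩ => hN ▸ (odeScatteringLength_trunc_mem hv hR N).2.le⟩
  have hle : ∀ N : ℕ, scatteringLength v ≤ ENNReal.ofReal (⨆ N : ℕ, odeScatteringLength (truncPotential v N) R) +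
      (ENNReal.ofReal (4 * Real.pi))⁻¹ * (2⁻¹ * ∫⁻ x : Space, (v ‖x‖ - truncPotential v N ‖x‖)) := by
    intro N
    refine (scatteringLength_le_trunc hv hR hvR N).trans ?_
    gcongr
    exact le_ciSup hbdd N
  have hlim : Tendsto (fun N : ℕ => ENNReal.ofReal (⨆ N : ℕ, odeScatteringLength (truncPotential v N) R) +
      (ENNReal.ofReal (4 * Real.pi))⁻¹ * (2⁻¹ * ∫⁻ x : Space, (v ‖x‖ - truncPotential v N ‖x‖))) atTop
      (𝓝 (ENNReal.ofReal (⨆ N : ℕ, odeScatteringLength (truncPotential v N) R) +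
        (ENNReal.ofReal (4 * Real.pi))⁻¹ * (2⁻¹ * 0))) := by
    refine tendsto_const_nhds.add (ENNReal.Tendsto.const_mul ?_ (Or.inr ?_))
    · exact ENNReal.Tendsto.const_mul (tendsto_lintegral_sub_trunc hv hint) (Or.inr (by norm_num))
    · exact ENNReal.inv_ne_top.mpr (by rw [ENNReal.ofReal_ne_zero_iff]; positivity)
  rw [mul_zero, mul_zero, add_zero] at hlim
  exact ge_of_tendsto' hlim hle

/-- Real form: `a(v) = a_∞`. [cite: LSSY2005, App. C, Thm. C.1] -/
theorem toReal_scatteringLength_eq_iSup :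
    (scatteringLength v).toReal = ⨆ N : ℕ, odeScatteringLength (truncPotential v N) R := by
  rw [scatteringLength_eq_iSup hv hR hvR hint, ENNReal.toReal_ofReal]
  exact (odeScatteringLength_trunc_mem hv hR 0).1.trans
    (le_ciSup ⟨R, fun _ ⟨N, hN⟩ => hN ▸ (odeScatteringLength_trunc_mem hv hR N).2.le⟩ 0)

end Limit

/-! ### The limiting profile solves the scattering problem -/

section Solution

variable {v : ℝ → ℝ≥0∞} {R : ℝ}
variable (hv : Measurable v) (hR : 0 < R) (hvR : ∀ s, R < s → v s = 0) (hint : (∫⁻ x : Space, v ‖x‖) ≠ ⊤)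
include hv hR hvR hint

/-- **`f_∞ = 1 - a/|x|` beyond any vanishing radius of `v`.** [cite: LSSY2005, App. C, Thm. C.1 (C.7); Fournais2020, (A.2)] -/
theorem scatteringProfileLim_eq_one_sub_div {ρ : ℝ} (hvρ : ∀ s, ρ < s → v s = 0) {x : Space} (hx : ρ < ‖x‖) :
    scatteringProfileLim v R x = 1 - (scatteringLength v).toReal / ‖x‖ := by
  have h1 := tendsto_scatteringProfile_trunc hv hR hvR x
  have h2 : Tendsto (fun N : ℕ => scatteringProfile (truncPotential v N) R x) atTop
      (𝓝 (1 - (⨆ N : ℕ, odeScatteringLength (truncPotential v N) R) / ‖x‖)) := by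
    have heq : (fun N : ℕ => scatteringProfile (truncPotential v N) R x) =
        fun N : ℕ => 1 - odeScatteringLength (truncPotential v N) R / ‖x‖ := by
      funext N
      exact scatteringProfile_eq_one_sub_div (measurable_truncPotential hv N) (truncPotential_le_ofReal v N)
        (Nat.cast_nonneg _) hR (truncPotential_eq_zero_of_range hvR N)
        (fun s hs => truncPotential_eq_zero (hvρ s hs) N) hx
    rw [heq]
    exact tendsto_const_nhds.sub ((tendsto_odeScatteringLength_trunc hv hR hvR).div_const _)
  rw [tendsto_nhds_unique h1 h2, toReal_scatteringLength_eq_iSup hv hR hvR hint]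

omit hv hR hvR hint in
/-- The truncated potentials converge in `ℝ≥0∞`. [folklore] -/
theorem tendsto_truncPotential (r : ℝ) : Tendsto (fun N : ℕ => truncPotential v N r) atTop (𝓝 (v r)) := by
  rw [← iSup_truncPotential v r]
  exact tendsto_atTop_iSup (monotone_truncPotential v r)

/-- **The weak equation passes to the limit.** [cite: Fournais2020, App. A (A.1); LSSY2005, App. C (C.1)] -/
theorem scatteringProfileLim_weak_eq (ψ : Space → ℝ) (hψ : ContDiff ℝ (⊤ : ℕ∞) ψ) (hψc : HasCompactSupport ψ) :
    ∫ x, scatteringProfileLim v R x * (Δ ψ) x =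
      2⁻¹ * ∫ x, (v ‖x‖).toReal * scatteringProfileLim v R x * ψ x := by
  have hψ2 : ContDiff ℝ 2 ψ := hψ.of_le (by norm_cast)
  -- the identities for the truncations
  have hN : ∀ N : ℕ, ∫ x, scatteringProfile (truncPotential v N) R x * (Δ ψ) x =
      2⁻¹ * ∫ x, (truncPotential v N ‖x‖).toReal * scatteringProfile (truncPotential v N) R x * ψ x := fun N =>
    integral_scatteringProfile_mul_laplacian (measurable_truncPotential hv N) (truncPotential_le_ofReal v N)
      (Nat.cast_nonneg _) R hψ hψc
  have hfc : ∀ N : ℕ, Continuous (scatteringProfile (truncPotential v N) R) := fun N =>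
    continuous_scatteringProfile (measurable_truncPotential hv N) (truncPotential_le_ofReal v N) (Nat.cast_nonneg _)
      hR (truncPotential_eq_zero_of_range hvR N)
  have hΔc : Continuous (Δ ψ) := Literature.Analysis.FluidPDE.continuous_laplacian hψ2
  have hΔs : HasCompactSupport (Δ ψ) :=
    hψc.mono' fun x hx => by
      by_contra h
      exact hx (by
        have := Literature.Analysis.FluidPDE.laplacian_eq_zero_of_notMem_tsupport (v := ψ) h
        exact absurd this (Function.mem_support.mp hx))
  have hΔi : Integrable (Δ ψ) := hΔc.integrable_of_hasCompactSupport hΔs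
  -- left-hand sides converge
  have hL : Tendsto (fun N : ℕ => ∫ x, scatteringProfile (truncPotential v N) R x * (Δ ψ) x) atTop
      (𝓝 (∫ x, scatteringProfileLim v R x * (Δ ψ) x)) := by
    refine tendsto_integral_of_dominated_convergence (fun x => ‖(Δ ψ) x‖) (fun N => ?_) hΔi.norm (fun N => ?_) ?_
    · exact ((hfc N).mul hΔc).aestronglyMeasurable
    · refine Eventually.of_forall fun x => ?_
      rw [norm_mul]
      refine mul_le_of_le_one_left (norm_nonneg _) ?_
      have h := scatteringProfile_trunc_mem hv hR hvR N x
      rw [Real.norm_eq_abs, abs_of_pos h.1]; exact h.2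
    · exact Eventually.of_forall fun x => (tendsto_scatteringProfile_trunc hv hR hvR x).mul_const _
  -- right-hand sides converge
  have hvi : Integrable fun x : Space => (v ‖x‖).toReal := integrable_toReal_of_lintegral_ne_top
    (hv.comp measurable_norm).aemeasurable hint
  obtain ⟨C, hC⟩ := hψc.exists_bound_of_continuous hψ.continuous
  have hae : ∀ᵐ x : Space, v ‖x‖ ≠ ⊤ := by
    have := ae_lt_top (hv.comp measurable_norm) hint
    filter_upwards [this] with x hx using hx.ne
  have hRt : Tendsto (fun N : ℕ => ∫ x, (truncPotential v N ‖x‖).toReal * scatteringProfile (truncPotential v N) R x * ψ x)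
      atTop (𝓝 (∫ x, (v ‖x‖).toReal * scatteringProfileLim v R x * ψ x)) := by
    refine tendsto_integral_of_dominated_convergence (fun x => (v ‖x‖).toReal * C) (fun N => ?_) (hvi.mul_const C)
      (fun N => ?_) ?_
    · exact ((((measurable_truncPotential hv N).comp measurable_norm).ennreal_toReal.mul (hfc N).measurable).mul
        hψ.continuous.measurable).aestronglyMeasurable
    · filter_upwards [hae] with x hx
      have h := scatteringProfile_trunc_mem hv hR hvR N x
      rw [norm_mul, norm_mul, Real.norm_eq_abs, Real.norm_eq_abs, abs_of_nonneg ENNReal.toReal_nonneg, abs_of_pos h.1]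
      have h1 : (truncPotential v N ‖x‖).toReal ≤ (v ‖x‖).toReal := ENNReal.toReal_mono hx (truncPotential_le v N _)
      have h2 := hC x
      have : 0 ≤ (truncPotential v N ‖x‖).toReal := ENNReal.toReal_nonneg
      calc (truncPotential v N ‖x‖).toReal * scatteringProfile (truncPotential v N) R x * ‖ψ x‖
          ≤ (v ‖x‖).toReal * 1 * C :=
            mul_le_mul (mul_le_mul h1 h.2 h.1.le ENNReal.toReal_nonneg) h2 (norm_nonneg _)
              (mul_nonneg ENNReal.toReal_nonneg zero_le_one)
        _ = (v ‖x‖).toReal * C := by rw [mul_one]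
    · filter_upwards [hae] with x hx
      refine ((((ENNReal.tendsto_toReal hx).comp (tendsto_truncPotential ‖x‖)).mul
        (tendsto_scatteringProfile_trunc hv hR hvR x)).mul_const (ψ x)).congr fun N => ?_
      rfl
  have hR2 := hRt.const_mul (2⁻¹ : ℝ)
  simp_rw [← hN] at hR2
  exact tendsto_nhds_unique hL hR2

/-- **`∫ v f_∞ = 8πa` in the limit.** [cite: Fournais2020, App. A (A.5)] -/
theorem lintegral_pot_mul_scatteringProfileLim :
    ∫⁻ x : Space, v ‖x‖ * ENNReal.ofReal (scatteringProfileLim v R x) = ENNReal.ofReal (8 * Real.pi) * scatteringLength v := by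
  have hN : ∀ N : ℕ, ∫⁻ x : Space, truncPotential v N ‖x‖ * ENNReal.ofReal (scatteringProfile (truncPotential v N) R x) =
      ENNReal.ofReal (8 * Real.pi) * ENNReal.ofReal (odeScatteringLength (truncPotential v N) R) := fun N => by
    rw [lintegral_pot_mul_scatteringProfile (measurable_truncPotential hv N) (truncPotential_le_ofReal v N)
      (Nat.cast_nonneg _) hR (truncPotential_eq_zero_of_range hvR N), scatteringLength_trunc hv hR hvR N]
  have hfc : ∀ N : ℕ, Continuous (scatteringProfile (truncPotential v N) R) := fun N =>
    continuous_scatteringProfile (measurable_truncPotential hv N) (truncPotential_le_ofReal v N) (Nat.cast_nonneg _)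
      hR (truncPotential_eq_zero_of_range hvR N)
  have hae : ∀ᵐ x : Space, v ‖x‖ ≠ ⊤ := by
    have := ae_lt_top (hv.comp measurable_norm) hint
    filter_upwards [this] with x hx using hx.ne
  -- dominated convergence in `ℝ≥0∞`
  have hL : Tendsto (fun N : ℕ => ∫⁻ x : Space, truncPotential v N ‖x‖ *
      ENNReal.ofReal (scatteringProfile (truncPotential v N) R x)) atTop
      (𝓝 (∫⁻ x : Space, v ‖x‖ * ENNReal.ofReal (scatteringProfileLim v R x))) := by
    refine tendsto_lintegral_of_dominated_convergence (fun x => v ‖x‖) (fun N => ?_) (fun N => ?_) hint ?_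
    · exact ((measurable_truncPotential hv N).comp measurable_norm).mul (hfc N).measurable.ennreal_ofReal
    · refine Eventually.of_forall fun x => ?_
      calc truncPotential v N ‖x‖ * ENNReal.ofReal (scatteringProfile (truncPotential v N) R x)
          ≤ truncPotential v N ‖x‖ * 1 := by
            gcongr
            rw [← ENNReal.ofReal_one]
            exact ENNReal.ofReal_le_ofReal (scatteringProfile_trunc_mem hv hR hvR N x).2
        _ ≤ v ‖x‖ := by rw [mul_one]; exact truncPotential_le v N _
    · filter_upwards [hae] with x hx
      exact ENNReal.Tendsto.mul (tendsto_truncPotential ‖x‖) (Or.inr ENNReal.ofReal_ne_top)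
        ((ENNReal.tendsto_ofReal (tendsto_scatteringProfile_trunc hv hR hvR x))) (Or.inr hx)
  have hRt : Tendsto (fun N : ℕ => ENNReal.ofReal (8 * Real.pi) * ENNReal.ofReal (odeScatteringLength (truncPotential v N) R))
      atTop (𝓝 (ENNReal.ofReal (8 * Real.pi) * ENNReal.ofReal (⨆ N : ℕ, odeScatteringLength (truncPotential v N) R))) :=
    ENNReal.Tendsto.const_mul (ENNReal.tendsto_ofReal (tendsto_odeScatteringLength_trunc hv hR hvR)) (Or.inr ENNReal.ofReal_ne_top)
  simp_rw [hN] at hL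
  rw [tendsto_nhds_unique hL hRt, scatteringLength_eq_iSup hv hR hvR hint]

/-- **The limiting profile is a scattering solution of `v`.** [cite: LSSY2005, App. C, Thm. C.1; Fournais2020, App. A (A.1)–(A.5)] -/
theorem isScatteringSolution_scatteringProfileLim :
    IsScatteringSolution v fun x => 1 - scatteringProfileLim v R x where
  measurable := measurable_const.sub (measurable_scatteringProfileLim hv hR hvR)
  nonneg x := by linarith [(scatteringProfileLim_mem hv hR hvR x).2]
  le_one x := by linarith [(scatteringProfileLim_mem hv hR hvR x).1]
  radial x y h := by simp only [scatteringProfileLim_radial v R h]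
  eq_div R₀ hR₀ x hx := by
    simp only [scatteringProfileLim_eq_one_sub_div hv hR hvR hint hR₀ hx]
    ring
  weak_eq ψ hψ hψc := by
    simp only [sub_sub_cancel]
    exact scatteringProfileLim_weak_eq hv hR hvR hint ψ hψ hψc
  lintegral_g := by
    simp only [sub_sub_cancel]
    exact lintegral_pot_mul_scatteringProfileLim hv hR hvR hint

end Solution

/-! ### The named fact, discharged -/

/-- **LSSY 2005, App. C, Thm. C.1 / Fournais 2020, App. A: existence of the scattering solution,
proved.** For every measurable non-negative radial potential of finite range with `∫_{ℝ³} v < ∞`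
there is `ω` with `(-Δ + ½v)(1 - ω) = 0` in `𝒟'(ℝ³)`, `0 ≤ ω ≤ 1`, `ω` radial, `ω = a/|x|` beyond
the range (`a` the variational scattering length) and `∫ v(1 - ω) = 8πa`.
[cite: LSSY2005, App. C, Thm. C.1 (C.1)–(C.8); Fournais2020, App. A (A.1)–(A.5)] -/
theorem LSSY2005_scatteringSolution_holds : LSSY2005_scatteringSolution := by
  intro v hv hint
  obtain ⟨hvm, R₀, hR₀⟩ := hv
  set R : ℝ := max R₀ 0 + 1 with hR_def
  have hR : 0 < R := by have := le_max_right R₀ 0; linarith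
  have hvR : ∀ s, R < s → v s = 0 := fun s hs => hR₀ s (by have := le_max_left R₀ 0; linarith)
  exact ⟨_, isScatteringSolution_scatteringProfileLim hvm hR hvR hint⟩

/-- **Fournais 2020, Theorem 1.2 from Lemma 2.4 alone.** With the scattering solution
(`LSSY2005_scatteringSolution_holds`) and (2.25) (`Fournais2020_eq225_holds`) discharged, the
vendored [Fournais2020, Thm. 1.2] (`Fournais2020_condensation`) follows from the single named fact
`Fournais2020_lemma24` [Fournais2020, Lemma 2.4 (2.26)–(2.42)], the second-quantised Bogoliubov bound.
[cite: Fournais2020, Thm. 1.2, Lemma 2.4, (2.25), App. A] -/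
theorem Fournais2020_condensation_of_lemma24 (h24 : Fournais2020_lemma24) : Fournais2020_condensation :=
  Fournais2020_condensation_of_scattering_eq225_lemma24 LSSY2005_scatteringSolution_holds
    Fournais2020_eq225_holds h24

/-- **Fournais 2020, Theorem 3.1 from Lemma 2.4 alone.** [cite: Fournais2020, Thm. 3.1, Lemma 2.4, (2.25), App. A] -/
theorem Fournais2020_thm31_of_lemma24 (h24 : Fournais2020_lemma24) : Fournais2020_thm31 :=
  Fournais2020_thm31_of_scattering_eq225_lemma24 LSSY2005_scatteringSolution_holds Fournais2020_eq225_holds h24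

end Literature.MathematicalPhysics.QuantumManyBody.BoseGas

end
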